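/-
Copyright: harness cell b2b-lgcu-borel (gen 26).  Honest framing: the VALUE here is a THEOREM
(a NEGATIVE verdict on an infinite slice of the crux: every prime `p`, every dimension `m ≥ 3`,
every `ε` below an explicit closed-form threshold `ε_F(p)`) — NOT summit progress; the crux item
`SubgroupIdentityDesigns` (stmt-MatrixMultiplication-14079) stays open and untouched.
-/
import Mathlib
import Summits.MatrixMultiplication.MatrixMultiplication.Theorems.SubgroupIdentityDesigns.Negative.LevelOneEpsilonUniform

/-!
# The closed form of the linear certificate: no level-one witness for `ε ≤ ε_F(p)`, every `m ≥ 3`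

Route `LevelGradedCohnUmans`, crux `SubgroupIdentityDesigns` (OPEN, untouched).  The file
`LevelOneEpsilonUniform` runs its linear certificate with RATIONAL data checked by `norm_num`, one
prime at a time.  Here the same two lemmas (`uniform_master`, `linear_absurd`) are run with the
EXACT real data `r = R = (p − 1)^{1/(2+ε)}`, `s₀ = √(p − 1)`, `κ₀ = κ = (4/27)^{1/6}` (so
`27 κ⁶ = 4`, `kappa_pow_six`), which turns the certificate into ONE closed-form hypothesis valid for
every prime:

`no_levelOne_witness_closedForm`: if `l ≥ 2` and
`κ · (√(p − 1) · (p² + p + 1) + 1/2) ≤ (p − 1)^{1/(2+ε)} · (p² + p)`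
then there is no level-one witness in `GL_{1+l}(𝔽_p)` at exponent `ε` (packaged against the crux
clause verbatim over all `m ≥ 3` in `no_crux_instance_closedForm`).  The hypothesis is monotone in
`ε` and reads `ε ≤ ε_F(p) := log(p − 1)/log(κ (√(p−1)(p²+p+1) + 1/2)/(p² + p)) − 2`; numerically
`ε_F(11) ≈ 0.7354`, `ε_F(13) ≈ 0.6706`, `ε_F(17) ≈ 0.5871`, `ε_F(23) ≈ 0.5145`, `ε_F(43) ≈ 0.4096`,
`ε_F(101) ≈ 0.3207`, `ε_F(1009) ≈ 0.2027` — above the squeeze threshold `ε_N(p)` of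
`LevelOneNeumannSqueeze` (`0.684, 0.625, 0.550, 0.484, 0.388, 0.305, 0.19`) at every prime
`p ≥ 11` (ratio `ε_F/ε_N` decreasing from `1.076` at `p = 11` to the limit `≈ 1.042`; both are
`~ c/log p`).  The ten rational cells of `LevelOneEpsilonUniform.no_levelOne_witness_allDim` are
instances up to rounding.

What this is NOT: nothing about `k ≥ 2`, nothing above `ε_F(p) < 1`, nothing about the summit.
VALUE = THEOREM (negative, uniform in `p` and in the dimension), NOT summit progress.
-/

set_option linter.dupNamespace false

noncomputable section

open scoped BigOperators Classical Matrix
open Module (finrank)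

namespace Summit.MatrixMultiplication.MatrixMultiplication.Theorems.SubgroupIdentityDesigns.Negative
namespace LevelOneEpsilonClosedForm

open Literature.Barriers.MatrixMultiplication (SubgroupTPP)
open Summit.MatrixMultiplication.MatrixMultiplication.Theorems.LieRankDesigns.Negative
open Summit.MatrixMultiplication.MatrixMultiplication.Theorems.LevelOneGL2Designs.Negative
open LevelOneFloorAll (sq_succ_le_b)
open LevelOneEpsilonUniform (uniform_master linear_absurd)

variable {p : ℕ} [hp : Fact p.Prime] {l : ℕ}

/-- `κ = (4/27)^{1/6}` has `27 κ⁶ = 4`. -/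
theorem kappa_pow_six : 27 * ((4 / 27 : ℝ) ^ ((1 : ℝ) / 6)) ^ 6 = 4 := by
  rw [← Real.rpow_natCast, ← Real.rpow_mul (by norm_num)]
  norm_num

/-- **THE CLOSED-FORM VERDICT.**  `l ≥ 2` and
`(4/27)^{1/6} (√(p−1) (p² + p + 1) + 1/2) ≤ (p − 1)^{1/(2+ε)} (p² + p)` ⇒ no level-one witness in
`GL_{1+l}(𝔽_p)` at exponent `ε` (i.e. for all `ε ≤ ε_F(p)`, every dimension `m = 1 + l ≥ 3`). -/
theorem no_levelOne_witness_closedForm (hl : 2 ≤ l) {ε : ℝ} (hε : -2 < ε)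
    (hcond : (4 / 27 : ℝ) ^ ((1 : ℝ) / 6) *
        (Real.sqrt ((p : ℝ) - 1) * ((p : ℝ) ^ 2 + p + 1) + 1 / 2) ≤
      ((p : ℝ) - 1) ^ (1 / (2 + ε)) * ((p : ℝ) ^ 2 + p))
    {H₁ H₂ H₃ : Subgroup (GLm p (1 + l))} (htpp : SubgroupTPP H₁ H₂ H₃)
    (hdes : ∃ c : Mat p (1 + l) → ℂ, (∀ M, 1 < M.rank → c M = 0) ∧
      (∑ M, c M * ZMod.stdAddChar (Matrix.trace (M * ((1 : GLm p (1 + l)) : Mat p (1 + l))))) = 1 ∧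
      ∀ a ∈ H₁, ∀ b ∈ H₂, ∀ g ∈ H₃, a * b * g ≠ 1 →
        (∑ M, c M * ZMod.stdAddChar
          (Matrix.trace (M * ((a * b * g : GLm p (1 + l)) : Mat p (1 + l))))) = 0) :
    ¬ budget p (1 + l) 1 (2 + ε) <
      ((Nat.card H₁ * Nat.card H₂ * Nat.card H₃ : ℕ) : ℝ) ^ ((2 + ε) / 3) := by
  intro hlt
  have hp2 : (2 : ℝ) ≤ p := by exact_mod_cast hp.out.two_le
  have ht0 : (0 : ℝ) < 2 + ε := by linarith
  have hM := uniform_master (by omega) hε le_rfl htpp hdes hlt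
  have hB0 : (p : ℝ) ^ 2 + p + 1 ≤ (((p ^ (1 + l) - 1) / (p - 1) : ℕ) : ℝ) := by
    exact_mod_cast sq_succ_le_b hl
  have hP1 : (0 : ℝ) ≤ (p : ℝ) - 1 := by linarith
  have hκ0 : (0 : ℝ) ≤ (4 / 27 : ℝ) ^ ((1 : ℝ) / 6) := Real.rpow_nonneg (by norm_num) _
  have hκ6 : (4 : ℝ) ≤ 27 * ((4 / 27 : ℝ) ^ ((1 : ℝ) / 6)) ^ 6 := kappa_pow_six.symm.le
  have hR0 : (0 : ℝ) ≤ ((p : ℝ) - 1) ^ (1 / (2 + ε)) := Real.rpow_nonneg hP1 _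
  have hRt : (((p : ℝ) - 1) ^ (1 / (2 + ε))) ^ (2 + ε) = (p : ℝ) - 1 := by
    rw [← Real.rpow_mul hP1, show 1 / (2 + ε) * (2 + ε) = 1 by field_simp, Real.rpow_one]
  have hs0 : (0 : ℝ) ≤ Real.sqrt ((p : ℝ) - 1) := Real.sqrt_nonneg _
  have hs : (p : ℝ) - 1 ≤ Real.sqrt ((p : ℝ) - 1) ^ 2 := (Real.sq_sqrt hP1).symm.le
  have hBpos : (0 : ℝ) < (p : ℝ) ^ 2 + p := by positivity
  have hA : (4 / 27 : ℝ) ^ ((1 : ℝ) / 6) * Real.sqrt ((p : ℝ) - 1) ≤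
      ((p : ℝ) - 1) ^ (1 / (2 + ε)) := by
    refine not_lt.mp fun h => ?_
    nlinarith [mul_lt_mul_of_pos_right h hBpos, mul_nonneg hκ0 hs0, hcond]
  have hcert : ((p : ℝ) - 1) ^ (1 / (2 + ε)) + (4 / 27 : ℝ) ^ ((1 : ℝ) / 6) / 2 ≤
      (((p : ℝ) - 1) ^ (1 / (2 + ε)) - (4 / 27 : ℝ) ^ ((1 : ℝ) / 6) * Real.sqrt ((p : ℝ) - 1)) *
        ((p : ℝ) ^ 2 + p + 1) := by
    linarith [hcond]
  exact linear_absurd (pm2 := (p : ℝ) - 2) ht0 hB0 (by nlinarith) (by ring) (by linarith) hR0 hRt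
    le_rfl hs0 hs hκ0 hκ6 hA hcert hM

/-- Packaged against the crux clause verbatim, over all dimensions `m ≥ 3`: under the closed-form
condition at `(p, ε)` the crux `SubgroupIdentityDesigns` has NO instance with `k = 1`, `m ≥ 3`. -/
theorem no_crux_instance_closedForm {ε : ℝ} (hε : -2 < ε)
    (hcond : (4 / 27 : ℝ) ^ ((1 : ℝ) / 6) *
        (Real.sqrt ((p : ℝ) - 1) * ((p : ℝ) ^ 2 + p + 1) + 1 / 2) ≤
      ((p : ℝ) - 1) ^ (1 / (2 + ε)) * ((p : ℝ) ^ 2 + p)) :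
    ¬ ∃ (m : ℕ) (_ : 3 ≤ m)
      (H₁ H₂ H₃ : Subgroup (Matrix.GeneralLinearGroup (Fin m) (ZMod p))),
      Literature.Barriers.MatrixMultiplication.SubgroupTPP H₁ H₂ H₃ ∧
      (∃ c : Matrix (Fin m) (Fin m) (ZMod p) → ℂ, (∀ M, 1 < M.rank → c M = 0) ∧
        (∑ M : Matrix (Fin m) (Fin m) (ZMod p), c M * ZMod.stdAddChar
          (Matrix.trace (M * ((1 : Matrix.GeneralLinearGroup (Fin m) (ZMod p)) :
            Matrix (Fin m) (Fin m) (ZMod p))))) = 1 ∧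
        ∀ a ∈ H₁, ∀ b ∈ H₂, ∀ g ∈ H₃, a * b * g ≠ 1 →
          (∑ M : Matrix (Fin m) (Fin m) (ZMod p), c M * ZMod.stdAddChar
            (Matrix.trace (M * ((a * b * g : Matrix.GeneralLinearGroup (Fin m) (ZMod p)) :
              Matrix (Fin m) (Fin m) (ZMod p))))) = 0) ∧
      (∑ᶠ χ ∈ Literature.RepresentationTheory.FiniteGroups.irrChars
          (Matrix.GeneralLinearGroup (Fin m) (ZMod p)) ∩
          {f | ∃ c : Matrix (Fin m) (Fin m) (ZMod p) → ℂ, (∀ M, 1 < M.rank → c M = 0) ∧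
            ∀ g : Matrix.GeneralLinearGroup (Fin m) (ZMod p), f g =
              ∑ M : Matrix (Fin m) (Fin m) (ZMod p), c M * ZMod.stdAddChar
                (Matrix.trace (M * (g : Matrix (Fin m) (Fin m) (ZMod p))))},
        (χ 1).re ^ (2 + ε)) <
        ((Nat.card H₁ * Nat.card H₂ * Nat.card H₃ : ℕ) : ℝ) ^ ((2 + ε) / 3) := by
  rintro ⟨m, hm, H₁, H₂, H₃, htpp, hdesign, hlt⟩
  obtain ⟨l, rfl⟩ : ∃ l, m = 1 + l := ⟨m - 1, by omega⟩
  exact no_levelOne_witness_closedForm (by omega) hε hcond htpp hdesign hlt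

end LevelOneEpsilonClosedForm
end Summit.MatrixMultiplication.MatrixMultiplication.Theorems.SubgroupIdentityDesigns.Negative
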